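import Literature.AnabelianGeometry.EtaleTheta.ThetaCoversModelDefs
import Literature.AnabelianGeometry.EtaleTheta.Discharge.Sec2ClassTwoCommutators
import Literature.AnabelianGeometry.EtaleTheta.Discharge.Sec1ZHatHeisenbergLevels
import HarnessLib

/-!
# [EtTh] §2 at the §1 MODEL, phase 1a numerology (part 1): the mod-`l` Heisenberg test group with its
# exponent, and why continuous maps from `Δ_X` to such groups kill `Ker(Δ_X ↠ Δ̄_X)` (proof-only)

Mochizuki, *The étale theta function …* [EtTh], Publ. RIMS **45** (2009), §2, PRIMS PDF p. 35
(printed p. 261): "`1 → Δ̄_Θ → Δ̄_X → Δ̄^ell_X → 1` — where `Δ̄_Θ ≅ (ℤ/lℤ)(1)`; `Δ̄^ell_X` is a free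
`(ℤ/lℤ)`-module of rank `2`" [cite: MochizukiEtTh2009, Def 2.1 p.35]; ERRATUM E1 ([IUTchI] Rmk. 3.1.6):
`l` ODD. PROOF-ONLY companion (seat abc-iut-L2-t10, gen 4; merge row W3-L2-02 / P2-a, L2-lead GO
2026-08-26T02:37:36Z) of `ThetaCoversModelDefs.lean` (`barKerHat`, `barThetaHat` inside the profinite
`Π_X = D.PiHat`); nothing of another seat is edited or restated. Consumed BY NAME: abc-iut-w5-d171's
Heisenberg test-group construction pattern (`Discharge/Sec1ZHatHeisenbergLevels`, cocycle extensions of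
`Literature.Algebra.Homology.TwoCocycleExtension`), abc-iut-L5-t14's `ClassTwo.isClosed_map_subtype_comap`.

* `ZHatLevels.exists_classTwo_exponent_commutator_orderOf` — for ODD `n`, a finite class-two group OF
  EXPONENT `n` with a commutator of order exactly `n` (the mod-`n` Heisenberg group as a cocycle
  extension; `(c, v)^n = (n c + n(n−1)/2 · v₁ v₂, n v) = 1` because `n` is odd — for even `n` no such
  group exists at `n = 2`, which is the group theory behind ERRATUM E1);
* `ThetaSetting.apply_eq_one_of_mem_barKerHat` — a continuous homomorphism from `Δ_X` to a finite
  class-two group of exponent dividing `l` kills `Ker(Δ_X ↠ Δ̄_X)`; `apply_eq_one_of_mem_barThetaHat` —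
  a continuous homomorphism to a finite ABELIAN group of exponent dividing `l` kills the `Δ̄_Θ`-preimage.
Part 2 (`ThetaCoversModelNumerology.lean`): `[barThetaHat : barKerHat] = l` and `Δ_X/barThetaHat ≅ (ℤ/l)²`.
HONEST FRAMING: kernel-checked group theory over abc-iut-L2-t1's data; the theta setting is not asserted
to exist; [EtTh] is refereed; nothing here takes a side on [IUTchIII] Cor. 3.12.
-/

noncomputable section

namespace Literature.AnabelianGeometry.EtaleTheta

open scoped commutatorElement

/-! ### The mod-`n` Heisenberg test group with its exponent (`n` odd) -/

namespace ZHatLevels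

open groupCohomology Literature.Algebra.Homology Literature.Topology.FourManifolds

/-- **The finite Heisenberg test group of ODD level `n`, with its exponent**: a finite group of
nilpotency class two and EXPONENT `n` with two elements `x, y` whose commutator has order exactly `n`
(the cocycle extension of `(ℤ/n)²` by `ℤ/n` with cocycle `B(v, w) = v₁ w₂`, abc-iut-w5-d171's test
group of `exists_classTwo_commutator_orderOf`; for `n` ODD, `(c, v)^n = (n c + n(n−1)/2 · v₁v₂, n v) = 1`
— for `n = 2` the group is the dihedral/quaternion-free exponent-4 group, which is why print needs `l`
odd, ERRATUM E1). [cite: MochizukiEtTh2009, Def 2.1 p.35] -/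
theorem exists_classTwo_exponent_commutator_orderOf (n : ℕ) (hodd : Odd n) :
    ∃ (H : Type) (_ : Group H) (_ : Finite H) (x y : H),
      orderOf (⁅x, y⁆ : H) = n ∧
      (∀ q ∈ (⁅⁅(⊤ : Subgroup H), (⊤ : Subgroup H)⁆, (⊤ : Subgroup H)⁆ : Subgroup H), q = 1) ∧
      ∀ h : H, h ^ n = 1 := by
  haveI : NeZero n := ⟨by obtain ⟨k, hk⟩ := hodd; omega⟩
  let B : (ZMod n × ZMod n) →+ (ZMod n × ZMod n) →+ ZMod n :=
    { toFun := fun v =>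
        { toFun := fun w => v.1 * w.2
          map_zero' := by simp
          map_add' := fun w w' => by simp only [Prod.snd_add, mul_add] }
      map_zero' := AddMonoidHom.ext fun w => by simp
      map_add' := fun v v' => AddMonoidHom.ext fun w => by
        simp only [AddMonoidHom.coe_mk, ZeroHom.coe_mk, AddMonoidHom.add_apply, Prod.fst_add,
          add_mul] }
  obtain ⟨f, hf⟩ := exists_cocycles₂_of_biadditive B
  haveI : Finite (Rep.trivial (ZMod n) (Multiplicative (ZMod n × ZMod n)) (ZMod n)) :=
    inferInstanceAs (Finite (ZMod n))
  let x : CocycleExtension f := ⟨0, Multiplicative.ofAdd (1, 0)⟩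
  let y : CocycleExtension f := ⟨0, Multiplicative.ofAdd (0, 1)⟩
  -- commutators in `E_f` are central, and `[x, y]` has order `n`
  have hQ1 : ∀ q ∈ (⁅(⊤ : Subgroup (CocycleExtension f)), (⊤ : Subgroup (CocycleExtension f))⁆ :
      Subgroup (CocycleExtension f)), ∃ c₀, q = CocycleExtension.inl f c₀ := by
    intro q hq
    have hle : (⁅(⊤ : Subgroup (CocycleExtension f)), (⊤ : Subgroup (CocycleExtension f))⁆ :
        Subgroup (CocycleExtension f)) ≤ (CocycleExtension.rightHom f).ker := by
      rw [← commutator_def]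
      exact Abelianization.commutator_subset_ker _
    have hq' := hle hq
    rw [← CocycleExtension.range_inl_eq_ker_rightHom] at hq'
    obtain ⟨c₀, hc₀⟩ := hq'
    exact ⟨c₀, hc₀.symm⟩
  have hcentral : ∀ (c₀) (q : CocycleExtension f), Commute (CocycleExtension.inl f c₀) q := by
    intro c₀ q
    have h := CocycleExtension.mul_inl_mul_inv f q c₀.toAdd
    rw [Rep.trivial_ρ_apply, ofAdd_toAdd] at h
    exact (mul_inv_eq_iff_eq_mul.mp h).symm
  have hQ3 : ∀ q ∈ (⁅⁅(⊤ : Subgroup (CocycleExtension f)), (⊤ : Subgroup (CocycleExtension f))⁆,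
      (⊤ : Subgroup (CocycleExtension f))⁆ : Subgroup (CocycleExtension f)), q = 1 := by
    have hle : (⁅⁅(⊤ : Subgroup (CocycleExtension f)), (⊤ : Subgroup (CocycleExtension f))⁆,
        (⊤ : Subgroup (CocycleExtension f))⁆ : Subgroup (CocycleExtension f)) ≤ ⊥ := by
      refine Subgroup.commutator_le.mpr fun c₀ hc₀ q _ => ?_
      obtain ⟨c₁, rfl⟩ := hQ1 c₀ hc₀
      rw [Subgroup.mem_bot, commutatorElement_eq_one_iff_commute]
      exact hcentral c₁ q
    exact fun q hq => (Subgroup.mem_bot).mp (hle hq)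
  have horder : orderOf (⁅x, y⁆ : CocycleExtension f) = n := by
    rw [commutatorElement_def,
      CocycleExtension.commutator_eq_inl_of_trivial f _ _ (Commute.all _ _), hf, hf]
    simp only [x, y, toAdd_ofAdd, B, AddMonoidHom.coe_mk, ZeroHom.coe_mk, mul_one, mul_zero, sub_zero]
    rw [orderOf_injective _ (CocycleExtension.inl_injective f), orderOf_ofAdd_eq_addOrderOf,
      ZMod.addOrderOf_one]
  -- EXPONENT: `(c, v)^m = (m • c + (∑_{i<m} i) • (v₁ v₂), m • v)`
  have hf11 : f (1, 1) = 0 := by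
    rw [hf]; simp [B]
  have hpow : ∀ (e : CocycleExtension f) (m : ℕ),
      (e ^ m).right = e.right ^ m ∧
      (e ^ m).left = m • e.left +
        ((Finset.range m).sum (fun i => i)) • ((e.right.toAdd).1 * (e.right.toAdd).2) := by
    intro e m
    induction m with
    | zero =>
      refine ⟨by simp, ?_⟩
      simp [CocycleExtension.one_left, hf11]
    | succ m ih =>
      obtain ⟨ihr, ihl⟩ := ih
      refine ⟨by rw [pow_succ, CocycleExtension.mul_right, ihr, pow_succ], ?_⟩
      rw [pow_succ, CocycleExtension.mul_left, ihl, ihr, hf, Finset.sum_range_succ]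
      simp only [Representation.trivial_apply]
      rw [toAdd_pow]
      simp only [B, AddMonoidHom.coe_mk, ZeroHom.coe_mk, Prod.smul_fst]
      simp only [add_smul, succ_nsmul, nsmul_eq_mul]
      ring
  have hsum : ∀ z : ZMod n, ((Finset.range n).sum (fun i => i)) • z = 0 := by
    intro z
    obtain ⟨k, hk⟩ := hodd
    have hs : (Finset.range n).sum (fun i => i) = n * k := by
      have h2 := Finset.sum_range_id_mul_two n
      rw [hk] at h2 ⊢
      have : (2 * k + 1) * (2 * k + 1 - 1) = (2 * k + 1) * k * 2 := by
        rw [Nat.add_sub_cancel]; ring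
      rw [this] at h2
      exact Nat.eq_of_mul_eq_mul_right two_pos h2
    rw [hs, nsmul_eq_mul, Nat.cast_mul, ZMod.natCast_self, zero_mul, zero_mul]
  refine ⟨CocycleExtension f, inferInstance, inferInstance, x, y, horder, hQ3, fun e => ?_⟩
  obtain ⟨hr, hl⟩ := hpow e n
  refine CocycleExtension.ext ?_ ?_
  · rw [hl, CocycleExtension.one_left, hf11, neg_zero, hsum, add_zero, nsmul_eq_mul,
      ZMod.natCast_self, zero_mul]
  · rw [hr, CocycleExtension.one_right, ← ofAdd_toAdd e.right, ← ofAdd_nsmul]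
    have h0 : n • (Multiplicative.toAdd e.right) = 0 := by
      ext <;> simp [nsmul_eq_mul]
    rw [h0, ofAdd_zero]

end ZHatLevels

namespace ThetaSetting

open Literature.AnabelianGeometry.SemiGraphs ZHatLevels ClassTwo

variable {p : ℕ} [Fact p.Prime] {D : ThetaSetting p} (l : ℕ)

/-! ### Continuous homomorphisms from `Δ_X` to discrete groups kill closed generated subgroups -/

/-- A homomorphism `F` from `Δ_X` to a group whose commutator subgroup receives `[Δ_X,Δ_X]`:
`F` maps (the `Δ_X`-part of) `[Δ_X,Δ_X] ≤ Π_X` into `[F(Δ_X),F(Δ_X)] ≤ [⊤,⊤]` (bookkeeping between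
subgroups of `Π_X` and of the subtype `Δ_X`). [cite: MochizukiEtTh2009, Def 2.1 p.35] -/
theorem commutator_le_map_subtype_comap {H : Type*} [Group H] (F : D.DeltaHat →* H) :
    ⁅D.DeltaHat, D.DeltaHat⁆ ≤
      (((⁅(⊤ : Subgroup H), (⊤ : Subgroup H)⁆ : Subgroup H).comap F).map D.DeltaHat.subtype) := by
  refine Subgroup.commutator_le.mpr fun u hu v hv => ?_
  refine ⟨⁅(⟨u, hu⟩ : D.DeltaHat), ⟨v, hv⟩⁆, ?_, rfl⟩
  rw [SetLike.mem_coe, Subgroup.mem_comap, map_commutatorElement]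
  exact Subgroup.commutator_mem_commutator (Subgroup.mem_top _) (Subgroup.mem_top _)

/-- The triple commutator `[[Δ_X,Δ_X],Δ_X] ≤ Π_X` is mapped by any `F : Δ_X → H` into `[[⊤,⊤],⊤]`.
[cite: MochizukiEtTh2009, Def 2.1 p.35] -/
theorem tripleCommutator_le_map_subtype_comap {H : Type*} [Group H] (F : D.DeltaHat →* H) :
    ⁅⁅D.DeltaHat, D.DeltaHat⁆, D.DeltaHat⁆ ≤
      (((⁅⁅(⊤ : Subgroup H), (⊤ : Subgroup H)⁆, (⊤ : Subgroup H)⁆ : Subgroup H).comap F).map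
        D.DeltaHat.subtype) := by
  refine Subgroup.commutator_le.mpr fun t ht d hd => ?_
  have htΔ : t ∈ D.DeltaHat := by
    haveI := D.deltaHat_normal'
    exact Subgroup.commutator_le_left _ _ ht
  refine ⟨⁅(⟨t, htΔ⟩ : D.DeltaHat), ⟨d, hd⟩⁆, ?_, rfl⟩
  rw [SetLike.mem_coe, Subgroup.mem_comap, map_commutatorElement]
  refine Subgroup.commutator_mem_commutator ?_ (Subgroup.mem_top _)
  exact mem_of_coe_mem_map_subtype_comap F _ (D.commutator_le_map_subtype_comap F ht)

/-- **A continuous homomorphism from `Δ_X` to a finite (discrete) group of nilpotency class `≤ 2`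
and exponent dividing `l` kills `Ker(Δ_X ↠ Δ̄_X)`** (its kernel, read in `Π_X`, is a closed subgroup
containing the triple commutators and the `l`-th powers). [cite: MochizukiEtTh2009, Def 2.1 p.35] -/
theorem apply_eq_one_of_mem_barKerHat {H : Type*} [Group H] [TopologicalSpace H] [DiscreteTopology H]
    (F : D.DeltaHat →* H) (hF : Continuous F)
    (h3 : ∀ q ∈ (⁅⁅(⊤ : Subgroup H), (⊤ : Subgroup H)⁆, (⊤ : Subgroup H)⁆ : Subgroup H), q = 1)
    (hexp : ∀ h : H, h ^ l = 1) {g : D.DeltaHat} (hg : (g : D.PiHat) ∈ D.barKerHat l) : F g = 1 := by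
  haveI : CompactSpace D.PiHat := D.isProfiniteCompletion_toHat.compactSpace
  haveI : T2Space D.PiHat := D.isProfiniteCompletion_toHat.t2Space
  have hΔclosed : IsClosed (D.DeltaHat : Set D.PiHat) := Subgroup.isClosed_topologicalClosure _
  let KF : Subgroup D.PiHat := ((⊥ : Subgroup H).comap F).map D.DeltaHat.subtype
  have hKF : IsClosed (KF : Set D.PiHat) := isClosed_map_subtype_comap hΔclosed F hF ⊥
  have hle : D.barKerHat l ≤ KF := by
    refine Subgroup.topologicalClosure_minimal _ (sup_le ?_ ?_) hKF
    · intro t ht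
      obtain ⟨t', ht', rfl⟩ := D.tripleCommutator_le_map_subtype_comap F ht
      refine ⟨t', ?_, rfl⟩
      rw [SetLike.mem_coe, Subgroup.mem_comap] at ht' ⊢
      exact (Subgroup.mem_bot).2 (h3 _ ht')
    · rw [D.deltaHatPow_eq_closure l, Subgroup.closure_le]
      rintro _ ⟨y, hy, rfl⟩
      refine ⟨⟨y, hy⟩ ^ l, ?_, rfl⟩
      rw [SetLike.mem_coe, Subgroup.mem_comap, map_pow]
      exact (Subgroup.mem_bot).2 (hexp _)
  exact (Subgroup.mem_bot).1 (mem_of_coe_mem_map_subtype_comap F ⊥ (hle hg))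

/-- The same for the `Δ̄_Θ`-preimage and an ABELIAN finite target of exponent dividing `l`.
[cite: MochizukiEtTh2009, Def 2.1 p.35] -/
theorem apply_eq_one_of_mem_barThetaHat {H : Type*} [CommGroup H] [TopologicalSpace H]
    [DiscreteTopology H] (F : D.DeltaHat →* H) (hF : Continuous F) (hexp : ∀ h : H, h ^ l = 1)
    {g : D.DeltaHat} (hg : (g : D.PiHat) ∈ D.barThetaHat l) : F g = 1 := by
  haveI : CompactSpace D.PiHat := D.isProfiniteCompletion_toHat.compactSpace
  haveI : T2Space D.PiHat := D.isProfiniteCompletion_toHat.t2Space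
  have hΔclosed : IsClosed (D.DeltaHat : Set D.PiHat) := Subgroup.isClosed_topologicalClosure _
  let KF : Subgroup D.PiHat := ((⊥ : Subgroup H).comap F).map D.DeltaHat.subtype
  have hKF : IsClosed (KF : Set D.PiHat) := isClosed_map_subtype_comap hΔclosed F hF ⊥
  have hle : D.barThetaHat l ≤ KF := by
    refine Subgroup.topologicalClosure_minimal _ (sup_le ?_ ?_) hKF
    · intro t ht
      obtain ⟨t', ht', rfl⟩ := D.commutator_le_map_subtype_comap F ht
      refine ⟨t', ?_, rfl⟩
      rw [SetLike.mem_coe, Subgroup.mem_comap] at ht' ⊢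
      have hbot : (⁅(⊤ : Subgroup H), (⊤ : Subgroup H)⁆ : Subgroup H) ≤ ⊥ :=
        Subgroup.commutator_le.2 fun u _ v _ => by
          rw [Subgroup.mem_bot, commutatorElement_eq_one_iff_commute]; exact Commute.all u v
      exact hbot ht'
    · rw [D.deltaHatPow_eq_closure l, Subgroup.closure_le]
      rintro _ ⟨y, hy, rfl⟩
      refine ⟨⟨y, hy⟩ ^ l, ?_, rfl⟩
      rw [SetLike.mem_coe, Subgroup.mem_comap, map_pow]
      exact (Subgroup.mem_bot).2 (hexp _)
  exact (Subgroup.mem_bot).1 (mem_of_coe_mem_map_subtype_comap F ⊥ (hle hg))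

end ThetaSetting

end Literature.AnabelianGeometry.EtaleTheta

end
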